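import Summits.Ventures.CertifiedQuantumChemistry.Certificates.HubbardRingL4SectorDQGDualFamily
import HarnessLib

/-!
# Ventures/CertifiedQuantumChemistry — Certificates/HubbardRingL4SectorDQGDualCheckS4b.lean: the order-`4` coefficient identity of the `√2` part of the
# explicit finite-`U` dual certificate family for the `(2,2)`-SECTOR (level-DQG) programme of the Hubbard 4-ring over `ℚ(√2)` — slices `p = 2, 3` of the `Γ`-defects, the `γ`-defects and the constant

HONEST FRAMING (verbatim): certified bounds for a stated model Hamiltonian in a stated basis; not a claim about the real molecule beyond that model. Kernel identities for an AUXILIARY dual object; no model value, no row, no claim node.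

Seat rdm-B (gen 45). The check `(dualS 4).check` (`DualL4.Dual.check`: all canonical `Γ`-, `γ`- and constant defects of the order-`4` record
vanish) is decided in SLICES — one kernel `decide` per site of the first orbital of the `Γ`-defect, one for the `γ`-defects, one for the constant —
because a single `decide` over the whole record does not evaluate at the denser orders (measured: order 2); the slices are combined into
`(dualS 4).check = true` in `…Ceiling.lean`. Offline the same identity was checked in exact arithmetic twice (`tools/x14-g45/dual4dqg/exactify_joint.py`,
`checkpy.py` = a re-implementation of `Dual.check` on the emitted tables). 0 sorry, 0 def; standard axioms.
-/

namespace Summit.Ventures.CertifiedQuantumChemistry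

namespace DualL4.SectorDQG

open Literature.MathematicalPhysics.QuantumLattice

/-- Order `4`, `√2` part: the canonical `Γ`-defects with first orbital on site `2` vanish (kernel). -/
theorem checkS4_g2 : ∀ σ : Fin 2, ∀ q : Fin 4, ∀ τ : Fin 2, ∀ r : Fin 4, ∀ υ : Fin 2, ∀ s : Fin 4, ∀ φ : Fin 2,
    (dualS 4).cdefΓ (orb 2 σ, orb q τ) (orb r υ, orb s φ) = 0 := by decide +kernel

/-- Order `4`, `√2` part: the canonical `Γ`-defects with first orbital on site `3` vanish (kernel). -/
theorem checkS4_g3 : ∀ σ : Fin 2, ∀ q : Fin 4, ∀ τ : Fin 2, ∀ r : Fin 4, ∀ υ : Fin 2, ∀ s : Fin 4, ∀ φ : Fin 2,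
    (dualS 4).cdefΓ (orb 3 σ, orb q τ) (orb r υ, orb s φ) = 0 := by decide +kernel

/-- Order `4`: the canonical `γ`-defects vanish (kernel). -/
theorem checkS4_h : ∀ p : Fin 4, ∀ σ : Fin 2, ∀ q : Fin 4, ∀ τ : Fin 2, (dualS 4).cdefγ (orb p σ) (orb q τ) = 0 := by
  decide +kernel

/-- Order `4`: the constant defect vanishes (kernel). -/
theorem checkS4_c : (dualS 4).def0 = 0 := by decide +kernel

end DualL4.SectorDQG

end Summit.Ventures.CertifiedQuantumChemistry
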